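import Literature.Computability.Cryptography.PeriodFindingDesc
import Literature.Computability.QuantumComplexity.CoreDescLayoutFP
import HarnessLib

/-!
# Period finding by eigenvalue estimation of shifts, XI: the description in closed form

Family `PQC` / quantum-advantage barrier `PPolyOracles`; eleventh file towards the discharge of
`Literature.Barriers.QuantumAdvantage.aaronsonChen2017_lem75_quantum`. The abstract gate list
`aoCirc S n σ` of the sandwich circuit around the block of a specification `S`
(`PeriodFindingDesc.lean`) is a functional program: ranges over the units, steps and bits,
affine wire arithmetic (`natAddr_*`), the adder template as a map over the bit range
(`AJLCore.map_addOps`, `stageA`), the queries with their prefixes. Here this closed form is written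
out for a GENERIC specification whose block lengths, levels and prefix bits are given by
functions on `ℕ` (`preNotsN`, `stepN`, `stepsN`, `wOpsN`, `queriesN`, `aoCircN`; `aoCirc_eqN`),
and specialised to the specification `spec P n` of the family (`spec_L`, `spec_lvl`, `getD_cpre`,
`σNat_eq`, `aoCirc_eq`), ready for the polynomial-time algebra `CodeFP` (Arora–Barak 2009, §6.2,
proof of Thm. 6.15: descriptions printed with counters).

## References

* S. Arora, B. Barak, *Computational Complexity: A Modern Approach*, CUP 2009, §6.2 [AroraBarak2009].
* V. Vedral, A. Barenco, A. Ekert, Phys. Rev. A 54 (1996), §3.1 [VedralBarencoEkert1996].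
-/

noncomputable section

namespace Literature.Computability.Cryptography

namespace PeriodFinding

open QuantumComplexity QuantumComplexity.RazTalMachine QuantumComplexity.RevSim QuantumComplexity.OSim
  QuantumComplexity.RevDesc QuantumComplexity.AJLCore Complexity _root_.Computability Finset Function Kitaev1995

/-! ### Ranges over `Fin` and over `ℕ` -/

/-- The values of `finRange`. [folklore] -/
theorem map_val_finRange (k : ℕ) : (List.finRange k).map Fin.val = List.range k := by
  apply List.ext_getElem (by simp)
  intro i h1 h2
  simp

/-- Ranges over `Fin` become ranges over `ℕ` under value-dependent maps. [folklore] -/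
theorem flatMap_finRange_val {β : Type} (k : ℕ) (G : ℕ → List β) :
    (List.finRange k).flatMap (fun i : Fin k => G (i : ℕ)) = (List.range k).flatMap G := by
  rw [← map_val_finRange, List.flatMap_map]

/-- Ranges over `Fin` become ranges over `ℕ` under value-dependent maps. [folklore] -/
theorem map_finRange_val {β : Type} (k : ℕ) (g : ℕ → β) :
    (List.finRange k).map (fun i : Fin k => g (i : ℕ)) = (List.range k).map g := by
  rw [← map_val_finRange, List.map_map]; rfl

/-- Filtered ranges over `Fin`. [folklore] -/
theorem map_filter_finRange_val {β : Type} (k : ℕ) (π : ℕ → Bool) (g : ℕ → β) :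
    ((List.finRange k).filter fun i : Fin k => π (i : ℕ)).map (fun i : Fin k => g (i : ℕ)) =
      ((List.range k).filter π).map g := by
  rw [← map_val_finRange, List.filter_map, List.map_map]; rfl

/-- Composition of wire maps on operations. [folklore] -/
theorem clOp_map_comp {ι κ μ : Type} (f : ι → κ) (g : κ → μ) :
    (ClOp.map g ∘ ClOp.map f) = ClOp.map (g ∘ f) := by
  funext op; cases op <;> rfl

/-! ### Generic closed forms -/

section Generic

variable (S : BSpec) (n : ℕ)

/-- Control wire. [folklore] -/
def ctrlA (u s : ℕ) : ℕ := n + (s + S.K * u)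
/-- Offset wire. [folklore] -/
def zbitA (u i : ℕ) : ℕ := n + (k₁ S + (i + S.Ltop * u))
/-- Prefix wire. [folklore] -/
def preA (j p : ℕ) : ℕ := n + ((k₁ S + k₂ S) + (p + S.plen * j))
/-- Fan-out register wire. [folklore] -/
def dregA (u s i : ℕ) : ℕ := n + ((k₁ S + k₂ S) + (S.Ltop * S.plen + ((i + ssz S * s) + usz S * u)))
/-- Sum register wire. [folklore] -/
def sregA (u s i : ℕ) : ℕ := n + ((k₁ S + k₂ S) + (S.Ltop * S.plen + (((S.Ltop + i) + ssz S * s) + usz S * u)))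
/-- Carry register wire. [folklore] -/
def cregA (u s i : ℕ) : ℕ :=
  n + ((k₁ S + k₂ S) + (S.Ltop * S.plen + (((S.Ltop + (S.Ltop + i)) + ssz S * s) + usz S * u)))
/-- Answer register wire. [folklore] -/
def yregA (u i : ℕ) : ℕ := n + ((k₁ S + k₂ S) + (S.Ltop * S.plen + ((S.K * ssz S + i) + usz S * u)))
/-- Accumulator wire of step `s`. [folklore] -/
def accA (u s i : ℕ) : ℕ := if s = 0 then zbitA S n u i else sregA S n u (s - 1) i

variable {S n}

/-- The accumulator wires. [folklore] -/
theorem natAddr_accW (u : Fin S.nU) (s : Fin S.K) (i : Fin S.Ltop) :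
    natAddr S n (accW S u s i) = accA S n u s i := by
  unfold accW accA
  by_cases h : (s : ℕ) = 0
  · rw [dif_pos h, if_pos h]; exact natAddr_zbit u i
  · rw [dif_neg h, if_neg h]; exact natAddr_sreg u _ i

/-- The placement of the adder, by cases. [folklore] -/
theorem emb_a (u : Fin S.nU) (s : Fin S.K) (i : Fin (S.L u)) : emb S u s (AddW.a i) = accW S u s (up S i) := rfl
/-- The placement of the adder, by cases. [folklore] -/
theorem emb_b (u : Fin S.nU) (s : Fin S.K) (i : Fin (S.L u)) : emb S u s (AddW.b i) = BW.dreg u s (up S i) := rfl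
/-- The placement of the adder, by cases. [folklore] -/
theorem emb_s (u : Fin S.nU) (s : Fin S.K) (i : Fin (S.L u)) : emb S u s (AddW.s i) = BW.sreg u s (up S i) := rfl
/-- The placement of the adder, by cases. [folklore] -/
theorem emb_c (u : Fin S.nU) (s : Fin S.K) (i : Fin (S.L u + 1)) : emb S u s (AddW.c i) = BW.creg u s (upc S i) := rfl

/-- The placed adder wires: accumulator. [folklore] -/
theorem emb_a_val (u : Fin S.nU) (s : Fin S.K) (j : Fin (S.L u)) :
    (natAddr S n ∘ emb S u s) (AddW.a j) = accA S n u s j := by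
  rw [Function.comp_apply, emb_a, natAddr_accW]; rfl

/-- The placed adder wires: fan-out register. [folklore] -/
theorem emb_b_val (u : Fin S.nU) (s : Fin S.K) (j : Fin (S.L u)) :
    (natAddr S n ∘ emb S u s) (AddW.b j) = dregA S n u s j := by
  rw [Function.comp_apply, emb_b, natAddr_dreg, Fin.val_castLE]; rfl

/-- The placed adder wires: sum register. [folklore] -/
theorem emb_s_val (u : Fin S.nU) (s : Fin S.K) (j : Fin (S.L u)) :
    (natAddr S n ∘ emb S u s) (AddW.s j) = sregA S n u s j := by
  rw [Function.comp_apply, emb_s, natAddr_sreg, Fin.val_castLE]; rfl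

/-- The placed adder wires: carries. [folklore] -/
theorem emb_c_val (u : Fin S.nU) (s : Fin S.K) (j : Fin (S.L u + 1)) :
    (natAddr S n ∘ emb S u s) (AddW.c j) = cregA S n u s j := by
  rw [Function.comp_apply, emb_c, natAddr_creg, Fin.val_castLE]; rfl

variable (S n)
variable (Lf : ℕ → ℕ) (lvf : ℕ → ℕ) (cpf : ℕ → ℕ → Bool)

/-- **The prefix writes.** [folklore] -/
def preNotsN : List (ClOp ℕ) :=
  (List.range S.Ltop).flatMap fun j => ((List.range S.plen).filter fun p => cpf j p).map fun p => ClOp.not (preA S n j p)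

/-- **The fan-out of a step.** [folklore] -/
def fanN (u s : ℕ) : List (ClOp ℕ) :=
  if lvf s < Lf u then
    ((List.range (Lf u)).filter fun i => lvf s ≤ i).map fun i => ClOp.cnot (ctrlA S n u s) (dregA S n u s i)
  else []

/-- **The adder of a step.** [cite: VedralBarencoEkert1996, §3.1] -/
def addN (u s : ℕ) : List (ClOp ℕ) :=
  (List.range (Lf u)).flatMap (stageA (accA S n u s) (dregA S n u s) (sregA S n u s) (cregA S n u s))

/-- **A step.** [folklore] -/
def stepN (u s : ℕ) : List (ClOp ℕ) := fanN S n Lf lvf u s ++ addN S n Lf u s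

/-- **All steps.** [folklore] -/
def stepsN : List (ClOp ℕ) := (List.range (S.nU * S.K)).flatMap fun m => stepN S n Lf lvf (m / S.K) (m % S.K)

/-- **The compute part.** [folklore] -/
def wOpsN : List (ClOp ℕ) := preNotsN S n cpf ++ stepsN S n Lf lvf

/-- The abstract gate of query `(u, j)`. [folklore] -/
def aoQueryN (u j : ℕ) : AO :=
  (true, (S.cpre j).length + Lf u,
    (List.range (S.cpre j).length).map (preA S n j) ++ (List.range (Lf u)).map (sregA S n u (S.K - 1)) ++ [yregA S n u j])

/-- **The queries in closed form.** [folklore] -/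
def queriesN : List AO := (List.range S.nU).flatMap fun u => (List.range (Lf u)).map (aoQueryN S n Lf u)

/-- **The abstract gate list in closed form.** [cite: AroraBarak2009, §6.2] -/
def aoCircN (σ : ℕ → Bool) : List AO :=
  aoHad n (k₁ S + k₂ S) ++
    ((wOpsN S n Lf lvf cpf).flatMap aoCl ++ queriesN S n Lf ++ (wOpsN S n Lf lvf cpf).reverse.flatMap aoCl) ++
    aoPhase n (k₁ S + k₂ S) σ ++ aoHad n (k₁ S)

variable {S n Lf lvf cpf}
variable (hL : ∀ u : Fin S.nU, S.L u = Lf u) (hlv : ∀ s : Fin S.K, S.lvl s = lvf s)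
  (hcp : ∀ (j : Fin S.Ltop) (p : ℕ), (S.cpre j).getD p false = cpf j p)

include hcp in
/-- The prefix writes in closed form. [folklore] -/
theorem map_preNots : (preNots S).map (ClOp.map (natAddr S n)) = preNotsN S n cpf := by
  rw [preNots, List.map_map, preOnes, List.map_flatMap, preNotsN,
    ← flatMap_finRange_val S.Ltop fun j =>
      ((List.range S.plen).filter fun p => cpf j p).map fun p => ClOp.not (preA S n j p)]
  refine List.flatMap_congr fun j _ => ?_
  rw [List.map_map, ← map_filter_finRange_val S.plen (fun p => cpf j p) fun p => ClOp.not (preA S n j p)]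
  have hf : ((ClOp.map (natAddr S n) ∘ ClOp.not) ∘ fun p : Fin S.plen => BW.pre j p) =
      fun p : Fin S.plen => ClOp.not (preA S n j p) := by
    funext p
    show ClOp.not (natAddr S n (BW.pre j p)) = _
    rw [natAddr_pre]; rfl
  have hπ : (fun p : Fin S.plen => decide ((S.cpre j).getD (p : ℕ) false = true)) = fun p : Fin S.plen => cpf j p := by
    funext p
    rw [hcp, Bool.decide_eq_true]
  rw [hf, hπ]

include hL hlv in
/-- The fan-out in closed form. [folklore] -/
theorem map_fanout (u : Fin S.nU) (s : Fin S.K) :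
    (fanout S u s).map (ClOp.map (natAddr S n)) = fanN S n Lf lvf u s := by
  rw [fanout, fanN, hL, hlv]
  split_ifs with h
  · rw [copyOps, fanPairs, List.map_map, List.map_map, ← hL,
      ← map_filter_finRange_val (S.L u) (fun i => decide (lvf s ≤ i)) fun i => ClOp.cnot (ctrlA S n u s) (dregA S n u s i)]
    have hf : ((ClOp.map (natAddr S n) ∘ fun p : BW S × BW S => ClOp.cnot p.1 p.2) ∘
        fun i : Fin (S.L u) => (BW.ctrl u s, BW.dreg u s (up S i))) =
        fun i : Fin (S.L u) => ClOp.cnot (ctrlA S n u s) (dregA S n u s i) := by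
      funext i
      show ClOp.cnot (natAddr S n (BW.ctrl u s)) (natAddr S n (BW.dreg u s (up S i))) = _
      rw [natAddr_ctrl, natAddr_dreg, Fin.val_castLE]; rfl
    have hπ : (fun i : Fin (S.L u) => decide (S.lvl s ≤ (i : ℕ))) = fun i : Fin (S.L u) => decide (lvf s ≤ i) := by
      funext i; rw [hlv]
    rw [hf, hπ]
  · rfl

include hL in
/-- The adder in closed form. [cite: VedralBarencoEkert1996, §3.1] -/
theorem map_adder (u : Fin S.nU) (s : Fin S.K) :
    (adder S u s).map (ClOp.map (natAddr S n)) = addN S n Lf u s := by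
  rw [adder, List.map_map, addN, clOp_map_comp, ← hL]
  exact map_addOps (natAddr S n ∘ emb S u s) _ _ _ _ (emb_a_val u s) (emb_b_val u s) (emb_s_val u s) (emb_c_val u s)

include hL hlv in
/-- The steps in closed form. [folklore] -/
theorem map_steps : ((steps S).flatMap (stepOps S)).map (ClOp.map (natAddr S n)) = stepsN S n Lf lvf := by
  rw [steps, List.flatMap_map, List.map_flatMap, stepsN,
    ← flatMap_finRange_val (S.nU * S.K) fun m => stepN S n Lf lvf (m / S.K) (m % S.K)]
  refine List.flatMap_congr fun m _ => ?_
  show ((stepOps S (finProdFinEquiv.symm m)).map (ClOp.map (natAddr S n))) = _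
  rw [stepOps, List.map_append, finProdFinEquiv_symm_apply, map_fanout hL hlv, map_adder hL, stepN, Fin.coe_divNat,
    Fin.coe_modNat]

include hL hlv hcp in
/-- **The compute part in closed form.** [folklore] -/
theorem wOpsNat_eq : wOpsNat S n = wOpsN S n Lf lvf cpf := by
  rw [wOpsNat, wOps, List.map_append, map_preNots hcp, map_steps hL hlv, wOpsN]

/-- The query wires of a query index (generic equation, by `rfl`). [folklore] -/
theorem qWires_mk (u : Fin S.nU) (j : Fin (S.L u)) : qWires S ⟨u, j⟩ = preWires S (upj S j) ++ xWires S u := rfl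

/-- The answer wire of a query index (generic equation, by `rfl`). [folklore] -/
theorem qTgt_mk (u : Fin S.nU) (j : Fin (S.L u)) : qTgt S ⟨u, j⟩ = BW.yreg u (up S j) := rfl

/-- The prefix wires in closed form. [folklore] -/
theorem map_natAddr_preWires (j : Fin S.Ltop) :
    (preWires S j).map (natAddr S n) = (List.range (S.cpre j).length).map (preA S n j) := by
  rw [preWires, List.map_map, ← map_finRange_val _ (preA S n j)]
  refine List.map_congr_left fun p _ => ?_
  simp only [Function.comp_apply]
  rw [natAddr_pre, Fin.val_castLE]
  rfl

/-- The `X` wires in closed form. [folklore] -/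
theorem map_natAddr_xWires (u : Fin S.nU) :
    (xWires S u).map (natAddr S n) = (List.range (S.L u)).map (sregA S n u (S.K - 1)) := by
  rw [xWires, List.map_map, ← map_finRange_val _ (sregA S n u (S.K - 1))]
  refine List.map_congr_left fun i _ => ?_
  simp only [Function.comp_apply]
  rw [natAddr_sreg, Fin.val_castLE]
  rfl

include hL in
/-- One query in closed form. [folklore] -/
theorem aoQuery_eq (u : Fin S.nU) (j : Fin (S.L u)) : aoQuery S n ⟨u, j⟩ = aoQueryN S n Lf u j := by
  rw [aoQuery, qWires_mk, qTgt_mk, List.map_append, map_natAddr_preWires, map_natAddr_xWires, natAddr_yreg,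
    List.length_append, preWires, List.length_map, List.length_finRange, xWires, List.length_map, List.length_finRange,
    aoQueryN, Fin.val_castLE, ← hL]
  rfl

include hL in
/-- The queries in closed form. [folklore] -/
theorem queries_eq : (qIdx S).map (aoQuery S n) = queriesN S n Lf := by
  rw [qIdx, List.map_flatMap, queriesN, ← flatMap_finRange_val S.nU fun u => (List.range (Lf u)).map (aoQueryN S n Lf u)]
  refine List.flatMap_congr fun u _ => ?_
  rw [List.map_map, ← hL, ← map_finRange_val (S.L u) (aoQueryN S n Lf u)]
  exact List.map_congr_left fun j _ => aoQuery_eq hL u j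

include hL hlv hcp in
/-- **The closed form is the abstract gate list**, generically. [cite: AroraBarak2009, §6.2] -/
theorem aoCirc_eqN (σ : Fin (k₁ S) → Bool) : aoCirc S n σ = aoCircN S n Lf lvf cpf (σNat S σ) := by
  rw [aoCirc, aoBlock, wOpsNat_eq hL hlv hcp, queries_eq hL, aoCircN]

end Generic

/-! ### The parameters of `spec P n` on `ℕ` -/

variable (P : FParams) (n : ℕ)

/-- Block length of unit `u`. [folklore] -/
def LofN (u : ℕ) : ℕ := n + u / 12
/-- Level of step `s`. [folklore] -/
def lvlN (s : ℕ) : ℕ := s / (2 * Bn P n)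

/-- Unit index of a unit. [folklore] -/
theorem val_eU_fst (u : Fin (nU P n)) : ((eU P n u).1 : ℕ) = u / 12 := by
  show ((Fin.divNat u : Fin (nL P n)) : ℕ) = _
  rw [Fin.coe_divNat]

/-- Half index of a unit. [folklore] -/
theorem val_eU_snd_fst (u : Fin (nU P n)) : ((eU P n u).2.1 : ℕ) = u % 12 / 6 := by
  show ((Fin.divNat (Fin.modNat u) : Fin 2) : ℕ) = _
  rw [Fin.coe_divNat, Fin.coe_modNat]

/-- Level of a step. [folklore] -/
theorem val_eK_fst (s : Fin (Kn P n)) : ((eK P n s).1 : ℕ) = s / (2 * Bn P n) := by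
  show ((Fin.divNat s : Fin (Lv P n)) : ℕ) = _
  rw [Fin.coe_divNat]

/-- Type of a step. [folklore] -/
theorem eK_snd_fst (s : Fin (Kn P n)) : (eK P n s).2.1 = decide (Bn P n ≤ s % (2 * Bn P n)) := by
  have hB := Bn_pos P n
  have hm : (s : ℕ) % (2 * Bn P n) < 2 * Bn P n := Nat.mod_lt _ (by omega)
  show ((Fin.divNat (Fin.modNat s) : Fin 2) == 1) = decide (Bn P n ≤ (s : ℕ) % (2 * Bn P n))
  have hv : ((Fin.divNat (Fin.modNat s) : Fin 2) : ℕ) = (s : ℕ) % (2 * Bn P n) / Bn P n := by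
    rw [Fin.coe_divNat, Fin.coe_modNat]
  by_cases h : Bn P n ≤ (s : ℕ) % (2 * Bn P n)
  · have h1 : (s : ℕ) % (2 * Bn P n) / Bn P n = 1 := Nat.div_eq_of_lt_le (by omega) (by omega)
    have : (Fin.divNat (Fin.modNat s) : Fin 2) = 1 := Fin.ext (by rw [hv, h1]; rfl)
    rw [this]; simp [h]
  · have h0 : (s : ℕ) % (2 * Bn P n) / Bn P n = 0 := Nat.div_eq_of_lt (by omega)
    have : (Fin.divNat (Fin.modNat s) : Fin 2) = 0 := Fin.ext (by rw [hv, h0]; rfl)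
    rw [this]; simp [h]

/-- The block lengths of `spec P n`. [folklore] -/
theorem spec_L (u : Fin (nU P n)) : (spec P n).L u = LofN n u := by
  show Lof P n u = _
  rw [Lof, val_eU_fst]
  rfl

/-- The levels of `spec P n`. [folklore] -/
theorem spec_lvl (s : Fin (Kn P n)) : (spec P n).lvl s = lvlN P n s := val_eK_fst P n s

/-- The bits of the prefixes: `1ⁿ 0 1ʲ 0`. [folklore] -/
def cpreBit (j p : ℕ) : Bool := decide (j < Ltop P n) && (decide (p < n) || (decide (n < p) && decide (p ≤ n + j)))

/-- The bits of the prefixes. [folklore] -/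
theorem getD_cpre (j p : ℕ) : (cpre P n j).getD p false = cpreBit P n j p := by
  unfold cpre cpreBit
  split_ifs with hj
  · simp only [hj, decide_true, Bool.true_and]
    rw [List.getD_eq_getElem?_getD]
    rcases lt_trichotomy p n with hp | rfl | hp
    · rw [List.getElem?_append_left (by simpa using hp)]
      simp [hp]
    · rw [List.getElem?_append_right (by simp)]
      simp
    · rw [List.getElem?_append_right (by simp; omega)]
      simp only [ones, List.length_replicate]
      obtain ⟨d, rfl⟩ : ∃ d, p = n + 1 + d := ⟨p - (n + 1), by omega⟩
      rw [show n + 1 + d - n = d + 1 by omega, List.getElem?_cons_succ]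
      by_cases hd : d < j
      · rw [List.getElem?_append_left (by simpa using hd)]
        simp [hd]; omega
      · rw [List.getElem?_append_right (by simpa using hd)]
        simp only [List.length_replicate]
        rcases Nat.lt_or_ge (d - j) 1 with h1 | h1
        · rw [show d - j = 0 by omega]; simp; omega
        · rw [List.getElem?_eq_none (by simp; omega)]; simp; omega
  · simp [hj]

/-- The prefix bits of `spec P n`. [folklore] -/
theorem spec_cpre (j : Fin (spec P n).Ltop) (p : ℕ) : ((spec P n).cpre j).getD p false = cpreBit P n j p :=
  getD_cpre P n j p

/-- The flags of the phase layer in closed form. [folklore] -/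
def σN (j : ℕ) : Bool := decide (j < k₁ (spec P n)) && decide (Bn P n ≤ j % Kn P n % (2 * Bn P n))

/-- The flags in closed form. [folklore] -/
theorem σNat_eq : σNat (spec P n) (famσ P n) = σN P n := by
  funext j
  unfold σNat σN
  by_cases hj : j < k₁ (spec P n)
  · rw [dif_pos hj]
    simp only [hj, decide_true, Bool.true_and, famσ]
    rw [eK_snd_fst, finProdFinEquiv_symm_apply, Fin.coe_modNat]
  · rw [dif_neg hj]
    simp [hj]

/-- **The abstract gate list of the `n`-th circuit of the family in closed form.**
[cite: AroraBarak2009, §6.2] -/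
theorem aoCirc_eq :
    aoCirc (spec P n) n (famσ P n) = aoCircN (spec P n) n (LofN n) (lvlN P n) (cpreBit P n) (σN P n) := by
  rw [aoCirc_eqN (S := spec P n) (Lf := LofN n) (lvf := lvlN P n) (cpf := cpreBit P n) (spec_L P n) (spec_lvl P n)
    (spec_cpre P n), σNat_eq]

end PeriodFinding

end Literature.Computability.Cryptography

end
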